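import Summits.Parity.BatemanHorn.Theorems.SelbergDelangeRigidityLSDRealSegmentTailsPeeled
import Summits.Parity.BatemanHorn.Theorems.SelbergDelangeRigidityLSDRealSegmentEulerFactorAux
import HarnessLib

/-!
# Route `SelbergDelangeRigidity`, crux `LSDRealSegment` (stmt-Parity-9770), line
# `product-anatomy-subcritical`: the rescaled systems of the small-prime restoration (algebra; `stub_tailsTwo`)

The small-prime restoration of `stub_tailsTwo` slices `n = r + M t` along residue classes `r mod M` (`M` a
`P`-smooth modulus) on which every value `fᵢ(n)` has a CONSTANT `P`-smooth part `bᵢ`, and applies Nair–Tenenbaum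
to the RESCALED system `Qᵢ(t) = fᵢ(r + M t)/bᵢ ∈ ℤ[X]`.  This file is the algebra of one rescaling, for a
polynomial `Q` characterised by `C b · Q = g ∘ (M X + r)` (`b ∣ M`, `b ∣ g(r)`; existence by Pollack's explicit
formula): values, degree, root counts to moduli prime to `M` (an affine bijection of `ℤ/m`), irreducibility over `ℤ`
of a primitive rescaling, coprimality over `ℚ`, and — the point where TOTAL DEGREE `2` enters — the discriminant of a
rescaled QUADRATIC: `b² · disc Q = M² · disc g` (`tailsTwo_rescale_discr`, registered helper), so that along the
slicing the discriminants stay in a finite set (`M/b` bounded), as the uniformity of Nair–Tenenbaum demands.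
-/

open Filter Finset Polynomial
open scoped BigOperators Topology Classical

namespace Summit.Parity.BatemanHorn.Cruxes.LSDRealSegment.ProductAnatomySubcritical

open Literature.NumberTheory.Sieve
open ArithmeticFunction (cardFactors)
noncomputable section

variable {k : ℕ}

/-! ### Existence and values -/

/-- **Pollack's rescaling**: for `b ∣ M` and `b ∣ g(r)` there is `Q ∈ ℤ[X]` with `C b · Q = g ∘ (M X + r)`
(explicitly `Q = C (g(r)/b) + (divX (taylor r g)) ∘ (M X) · ((M/b) X)`). [folklore] -/
-- adapted from `Literature.Barriers.Parity.EuclideanProofsPollackProofs` (private `C_mul_hpoly`)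
theorem exists_rescale (g : ℤ[X]) (r : ℤ) {M b : ℕ} (hbM : b ∣ M) (hbg : (b : ℤ) ∣ g.eval r) :
    ∃ Q : ℤ[X], C (b : ℤ) * Q = g.comp (C (M : ℤ) * X + C r) := by
  obtain ⟨e, hge⟩ := hbg
  obtain ⟨M', hM'⟩ := hbM
  refine ⟨C e + (divX (taylor r g)).comp (C (M : ℤ) * X) * (C (M' : ℤ) * X), ?_⟩
  have h1 : g.comp (C (M : ℤ) * X + C r) = (taylor r g).comp (C (M : ℤ) * X) := by
    rw [taylor_apply, comp_assoc]
    congr 1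
    simp only [add_comp, X_comp, C_comp]
  rw [h1]
  conv_rhs => rw [← divX_mul_X_add (taylor r g)]
  rw [taylor_coeff_zero, hge, add_comp, mul_comp, X_comp, C_comp, hM']
  push_cast
  simp only [C_mul]
  ring

section OneRescaling

variable {g Q : ℤ[X]} {r : ℤ} {M b : ℕ}

/-- Values: `b · Q(t) = g(M t + r)`. [folklore] -/
theorem rescale_eval (hQ : C (b : ℤ) * Q = g.comp (C (M : ℤ) * X + C r)) (t : ℤ) :
    (b : ℤ) * Q.eval t = g.eval (M * t + r) := by
  have := congr_arg (eval t) hQ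
  simpa [eval_comp] using this

/-- Degree: `deg Q = deg g` (`M, b ≥ 1`). [folklore] -/
theorem rescale_natDegree (hQ : C (b : ℤ) * Q = g.comp (C (M : ℤ) * X + C r)) (hM : 0 < M) (hb : 0 < b) :
    Q.natDegree = g.natDegree := by
  have hb0 : (b : ℤ) ≠ 0 := by exact_mod_cast hb.ne'
  have hM0 : (M : ℤ) ≠ 0 := by exact_mod_cast hM.ne'
  have := congr_arg natDegree hQ
  rwa [natDegree_C_mul hb0, natDegree_comp, natDegree_linear hM0, mul_one] at this

/-- The rescaling, mapped to a commutative ring. [folklore] -/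
theorem rescale_map {R : Type*} [CommRing R] (φ : ℤ →+* R) (hQ : C (b : ℤ) * Q = g.comp (C (M : ℤ) * X + C r)) :
    C (φ b) * Q.map φ = (g.map φ).comp (C (φ M) * X + C (φ r)) := by
  have := congr_arg (Polynomial.map φ) hQ
  simpa [Polynomial.map_mul, Polynomial.map_comp, Polynomial.map_add] using this

/-- **Root counts to moduli prime to `M`**: `ρ_Q(m) = ρ_g(m)` when `(M, m) = (b, m) = 1` (the affine map
`x ↦ M x + r` is a bijection of `ℤ/m`, and `b` is a unit there). [folklore] -/
theorem polyRootCountMod_rescale (hQ : C (b : ℤ) * Q = g.comp (C (M : ℤ) * X + C r)) {m : ℕ} (hm : m ≠ 0)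
    (hMm : M.Coprime m) (hbm : b.Coprime m) : polyRootCountMod ![Q] m = polyRootCountMod ![g] m := by
  classical
  haveI : NeZero m := ⟨hm⟩
  set φ := Int.castRingHom (ZMod m) with hφ
  set uM : (ZMod m)ˣ := ZMod.unitOfCoprime M hMm with huM
  set ub : (ZMod m)ˣ := ZMod.unitOfCoprime b hbm with hub
  have hmap := rescale_map φ hQ
  have hφM : φ M = (uM : ZMod m) := by rw [huM, ZMod.coe_unitOfCoprime, hφ, eq_intCast, Int.cast_natCast]
  have hφb : φ b = (ub : ZMod m) := by rw [hub, ZMod.coe_unitOfCoprime, hφ, eq_intCast, Int.cast_natCast]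
  have key : ∀ x : ZMod m, (ub : ZMod m) * (Q.map φ).eval x = (g.map φ).eval ((uM : ZMod m) * x + φ r) := by
    intro x
    have := congr_arg (eval x) hmap
    simpa [eval_comp, hφM, hφb] using this
  rw [polyRootCountMod_single_eq_card_zmod, polyRootCountMod_single_eq_card_zmod]
  refine Finset.card_nbij' (fun x => (uM : ZMod m) * x + φ r) (fun y => (uM⁻¹ : (ZMod m)ˣ) * (y - φ r))
    ?_ ?_ ?_ ?_
  · intro x hx
    simp only [mem_coe, mem_filter, mem_univ, true_and] at hx ⊢
    rw [← key x, hx, mul_zero]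
  · intro y hy
    simp only [mem_coe, mem_filter, mem_univ, true_and] at hy ⊢
    have h := key ((uM⁻¹ : (ZMod m)ˣ) * (y - φ r))
    rw [← mul_assoc, Units.mul_inv, one_mul, sub_add_cancel, hy] at h
    exact (Units.mul_right_eq_zero ub).mp h
  · intro x _
    simp only [add_sub_cancel_right, ← mul_assoc, Units.inv_mul, one_mul]
  · intro y _
    simp only [← mul_assoc, Units.mul_inv, one_mul, sub_add_cancel]

/-- **Irreducibility**: a PRIMITIVE rescaling of an irreducible non-constant `g` is irreducible in `ℤ[X]`
(over `ℚ`, `X ↦ M X + r` is an automorphism of `ℚ[X]`; Gauss). [folklore] -/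
-- adapted from `Literature.Barriers.Parity.EuclideanProofsPollackProofs` (proof of `exists_prime_cofactors_of_hypothesisH`)
theorem rescale_irreducible (hQ : C (b : ℤ) * Q = g.comp (C (M : ℤ) * X + C r)) (hM : 0 < M) (hb : 0 < b)
    (hg : Irreducible g) (hdeg : 0 < g.natDegree) (hprim : Q.IsPrimitive) : Irreducible Q := by
  have hgQ : Irreducible (g.map (Int.castRingHom ℚ)) :=
    (IsPrimitive.Int.irreducible_iff_irreducible_map_cast (hg.isPrimitive hdeg.ne')).mp hg
  have hmap := rescale_map (Int.castRingHom ℚ) hQ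
  simp only [eq_intCast, Int.cast_natCast] at hmap
  have hM0 : ((M : ℚ)) ≠ 0 := by exact_mod_cast hM.ne'
  have hb0 : ((b : ℚ)) ≠ 0 := by exact_mod_cast hb.ne'
  haveI : Invertible (M : ℚ) := invertibleOfNonzero hM0
  have hcomp : Irreducible ((g.map (Int.castRingHom ℚ)).comp (C (M : ℚ) * X + C ((r : ℤ) : ℚ))) := by
    have := (MulEquiv.irreducible_iff (algEquivCMulXAddC (M : ℚ) ((r : ℤ) : ℚ)).toMulEquiv).mpr hgQ
    simpa [comp_eq_aeval] using this
  rw [← hmap] at hcomp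
  have hirrQ : Irreducible (Q.map (Int.castRingHom ℚ)) :=
    (irreducible_isUnit_mul (isUnit_C.mpr (IsUnit.mk0 _ hb0))).mp hcomp
  exact (IsPrimitive.Int.irreducible_iff_irreducible_map_cast hprim).mpr hirrQ

end OneRescaling

/-! ### Two rescalings: coprimality over `ℚ` -/

/-- Coprimality over `ℚ` passes to rescalings (compose a Bézout identity with `X ↦ M X + r`; `bᵢ` are units). [folklore] -/
theorem isCoprime_rescale {g₁ g₂ Q₁ Q₂ : ℤ[X]} {r : ℤ} {M b₁ b₂ : ℕ}
    (h₁ : C (b₁ : ℤ) * Q₁ = g₁.comp (C (M : ℤ) * X + C r)) (h₂ : C (b₂ : ℤ) * Q₂ = g₂.comp (C (M : ℤ) * X + C r))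
    (hcop : IsCoprime (g₁.map (Int.castRingHom ℚ)) (g₂.map (Int.castRingHom ℚ))) :
    IsCoprime (Q₁.map (Int.castRingHom ℚ)) (Q₂.map (Int.castRingHom ℚ)) := by
  set φ := Int.castRingHom ℚ
  set L : ℚ[X] := C (φ M) * X + C (φ r) with hL
  obtain ⟨u, v, huv⟩ := hcop
  have hcomp : IsCoprime ((g₁.map φ).comp L) ((g₂.map φ).comp L) := by
    refine ⟨u.comp L, v.comp L, ?_⟩
    have := congr_arg (fun p : ℚ[X] => p.comp L) huv
    simpa only [add_comp, mul_comp, one_comp] using this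
  rw [← rescale_map φ h₁, ← rescale_map φ h₂] at hcomp
  exact hcomp.of_mul_left_right.of_mul_right_right

/-! ### Systems: root counts of the rescaled product -/

/-- For a system rescaled member by member, `ρ` of the rescaled system agrees with `ρ` of the system at every
modulus prime to `M` (and to the `bᵢ`). [folklore] -/
theorem polyRootCountMod_rescale_system {f Q : Fin k → ℤ[X]} {r : ℤ} {M : ℕ} {b : Fin k → ℕ}
    (hQ : ∀ i, C (b i : ℤ) * Q i = (f i).comp (C (M : ℤ) * X + C r)) {m : ℕ} (hm : m ≠ 0) (hMm : M.Coprime m)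
    (hbm : ∀ i, (b i).Coprime m) : polyRootCountMod Q m = polyRootCountMod f m := by
  rw [polyRootCountMod_eq_single_prod Q, polyRootCountMod_eq_single_prod f]
  have hprod : C ((∏ i, b i : ℕ) : ℤ) * ∏ i, Q i = (∏ i, f i).comp (C (M : ℤ) * X + C r) := by
    rw [Polynomial.prod_comp, ← Finset.prod_congr rfl fun i _ => hQ i, Finset.prod_mul_distrib, Nat.cast_prod,
      map_prod]
  exact polyRootCountMod_rescale hprod hm hMm (Nat.Coprime.prod_left fun i _ => hbm i)

/-! ### Heights -/

/-- A polynomial all of whose coefficients are `≤ B` in absolute value has height `≤ B`. [folklore] -/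
theorem polyHeight_le_of_coeff_le {T : ℤ[X]} {B : ℕ} (h : ∀ i, (T.coeff i).natAbs ≤ B) : polyHeight T ≤ B :=
  Finset.sup_le fun i _ => h i

/-! ### Total degree two: coefficients, height and discriminant of the rescaled product -/

section Quadratic

variable {F H : ℤ[X]} {r : ℤ} {M : ℕ}

/-- A quadratic composed with `M X + r`, written out. [folklore] -/
theorem comp_linear_eq_of_natDegree_eq_two (hF : F.natDegree = 2) (M r : ℤ) :
    F.comp (C M * X + C r) = C (F.coeff 2 * M ^ 2) * X ^ 2 + C ((2 * F.coeff 2 * r + F.coeff 1) * M) * X +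
      C (F.coeff 2 * r ^ 2 + F.coeff 1 * r + F.coeff 0) := by
  conv_lhs => rw [F.as_sum_range_C_mul_X_pow, hF]
  simp only [Finset.sum_range_succ, Finset.sum_range_zero, zero_add, add_comp, mul_comp, C_comp, pow_comp, X_comp,
    pow_zero, mul_one, pow_one]
  simp only [map_mul, map_add, map_pow, map_ofNat]
  ring

/-- The three coefficients of a quadratic composed with `M X + r`. [folklore] -/
theorem coeff_comp_linear_of_natDegree_eq_two (hF : F.natDegree = 2) (M r : ℤ) :
    (F.comp (C M * X + C r)).coeff 2 = F.coeff 2 * M ^ 2 ∧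
    (F.comp (C M * X + C r)).coeff 1 = (2 * F.coeff 2 * r + F.coeff 1) * M ∧
    (F.comp (C M * X + C r)).coeff 0 = F.coeff 2 * r ^ 2 + F.coeff 1 * r + F.coeff 0 := by
  rw [comp_linear_eq_of_natDegree_eq_two hF]
  simp only [coeff_add, coeff_C_mul_X_pow, coeff_C_mul_X, coeff_C]
  norm_num

/-- Coefficients beyond the degree vanish. [folklore] -/
theorem coeff_comp_linear_eq_zero_of_natDegree_eq_two (hF : F.natDegree = 2) (M r : ℤ) {i : ℕ} (hi : 3 ≤ i) :
    (F.comp (C M * X + C r)).coeff i = 0 := by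
  rw [comp_linear_eq_of_natDegree_eq_two hF]
  have h2 : i ≠ 2 := by omega
  have h1 : i ≠ 1 := by omega
  have h0 : i ≠ 0 := by omega
  simp only [coeff_add, coeff_C_mul_X_pow, coeff_C_mul_X, coeff_C, if_neg h2, if_neg h1, if_neg h0, add_zero]

/-- **Height of a rescaled quadratic**: if `C B · G = F ∘ (M X + r)` with `B, M ≥ 1`, every coefficient of `G` is
at most `(|F₂| + |F₁| + |F₀|)(M + |r|)²` in absolute value, hence so is `‖G‖`. [folklore] -/
theorem polyHeight_rescale_le_of_natDegree_eq_two {G : ℤ[X]} {B : ℕ} (hF : F.natDegree = 2) (hM : 0 < M)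
    (hB : 0 < B) (hG : C (B : ℤ) * G = F.comp (C (M : ℤ) * X + C r)) :
    polyHeight G ≤ ((F.coeff 2).natAbs + (F.coeff 1).natAbs + (F.coeff 0).natAbs) * (M + r.natAbs) ^ 2 := by
  set S : ℕ := M + r.natAbs with hS
  set a : ℕ := (F.coeff 2).natAbs with ha
  set b' : ℕ := (F.coeff 1).natAbs with hb'
  set c : ℕ := (F.coeff 0).natAbs with hc
  have hS1 : 1 ≤ S := by omega
  have hSS : S ≤ S ^ 2 := by nlinarith
  have hMS : M ≤ S ^ 2 := le_trans (by omega) hSS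
  have hrS : r.natAbs ≤ S ^ 2 := le_trans (by omega) hSS
  have hr2S : r.natAbs ^ 2 ≤ S ^ 2 := Nat.pow_le_pow_left (by omega) 2
  have hM2S : M ^ 2 ≤ S ^ 2 := Nat.pow_le_pow_left (by omega) 2
  have h2rM : 2 * r.natAbs * M ≤ S ^ 2 := by
    have : S ^ 2 = M ^ 2 + 2 * r.natAbs * M + r.natAbs ^ 2 := by rw [hS]; ring
    omega
  refine polyHeight_le_of_coeff_le fun i => ?_
  -- `|G_i| ≤ |B G_i| = |(F ∘ L)_i|`
  have hcoeff : (B : ℤ) * G.coeff i = (F.comp (C (M : ℤ) * X + C r)).coeff i := by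
    rw [← hG, coeff_C_mul]
  have hle : (G.coeff i).natAbs ≤ ((F.comp (C (M : ℤ) * X + C r)).coeff i).natAbs := by
    rw [← hcoeff, Int.natAbs_mul, Int.natAbs_natCast]
    exact Nat.le_mul_of_pos_left _ hB
  refine hle.trans ?_
  obtain ⟨h2, h1, h0⟩ := coeff_comp_linear_of_natDegree_eq_two hF (M : ℤ) r
  rcases Nat.lt_or_ge i 3 with hi | hi
  · interval_cases i
    · rw [h0]
      calc (F.coeff 2 * r ^ 2 + F.coeff 1 * r + F.coeff 0).natAbs
          ≤ (F.coeff 2 * r ^ 2 + F.coeff 1 * r).natAbs + c := Int.natAbs_add_le _ _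
        _ ≤ (F.coeff 2 * r ^ 2).natAbs + (F.coeff 1 * r).natAbs + c :=
            Nat.add_le_add_right (Int.natAbs_add_le _ _) _
        _ = a * r.natAbs ^ 2 + b' * r.natAbs + c := by rw [Int.natAbs_mul, Int.natAbs_mul, Int.natAbs_pow]
        _ ≤ a * S ^ 2 + b' * S ^ 2 + c * S ^ 2 :=
            add_le_add (add_le_add (Nat.mul_le_mul_left a hr2S) (Nat.mul_le_mul_left b' hrS))
              (Nat.le_mul_of_pos_right c (by positivity))
        _ = (a + b' + c) * S ^ 2 := by ring
    · rw [h1, Int.natAbs_mul, Int.natAbs_natCast]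
      calc (2 * F.coeff 2 * r + F.coeff 1).natAbs * M ≤ ((2 * F.coeff 2 * r).natAbs + b') * M :=
            Nat.mul_le_mul_right _ (Int.natAbs_add_le _ _)
        _ = a * (2 * r.natAbs * M) + b' * M := by
            rw [Int.natAbs_mul, Int.natAbs_mul, show (2 : ℤ).natAbs = 2 from rfl]
            ring
        _ ≤ a * S ^ 2 + b' * S ^ 2 := add_le_add (Nat.mul_le_mul_left a h2rM) (Nat.mul_le_mul_left b' hMS)
        _ ≤ (a + b' + c) * S ^ 2 := by nlinarith
    · rw [h2, Int.natAbs_mul, Int.natAbs_pow, Int.natAbs_natCast]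
      calc a * M ^ 2 ≤ a * S ^ 2 := Nat.mul_le_mul_left a hM2S
        _ ≤ (a + b' + c) * S ^ 2 := by nlinarith
  · rw [coeff_comp_linear_eq_zero_of_natDegree_eq_two hF _ _ hi]
    simp

/-- **tailsTwo_rescale_discr** (registered helper of `stub_tailsTwo`, line `product-anatomy-subcritical`): the
discriminant of a rescaled QUADRATIC — if `deg F = 2` and `C B · G = F ∘ (M X + r)` with `B ≥ 1`, `M ≥ 1`, then
`B² · disc G = M² · disc F` (so `|disc G| ≤ (M/B)² |disc F|`: finitely many discriminants along a slicing with
`M/B` bounded — the uniformity Nair–Tenenbaum needs, available exactly in total degree `2`). [folklore] -/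
theorem tailsTwo_rescale_discr : ∀ (F G : ℤ[X]) (r : ℤ) (M B : ℕ), F.natDegree = 2 → 0 < M → 0 < B →
    C (B : ℤ) * G = F.comp (C (M : ℤ) * X + C r) → (B : ℤ) ^ 2 * G.discr = (M : ℤ) ^ 2 * F.discr := by
  intro F G r M B hF hM hB hG
  have hB0 : (B : ℤ) ≠ 0 := by exact_mod_cast hB.ne'
  have hM0 : (M : ℤ) ≠ 0 := by exact_mod_cast hM.ne'
  have hdegG : G.natDegree = 2 := by
    have := congr_arg natDegree hG
    rwa [natDegree_C_mul hB0, natDegree_comp, natDegree_linear hM0, mul_one, hF] at this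
  have hdF : F.degree = 2 := by rw [degree_eq_natDegree (by rintro rfl; simp at hF), hF]; rfl
  have hdG : G.degree = 2 := by rw [degree_eq_natDegree (by rintro rfl; simp at hdegG), hdegG]; rfl
  rw [discr_of_degree_eq_two hdF, discr_of_degree_eq_two hdG]
  obtain ⟨h2, h1, h0⟩ := coeff_comp_linear_of_natDegree_eq_two hF (M : ℤ) r
  have hc : ∀ i, (B : ℤ) * G.coeff i = (F.comp (C (M : ℤ) * X + C r)).coeff i := fun i => by
    rw [← hG, coeff_C_mul]
  have e2 := hc 2
  have e1 := hc 1
  have e0 := hc 0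
  rw [h2] at e2
  rw [h1] at e1
  rw [h0] at e0
  have : (B : ℤ) ^ 2 * (G.coeff 1 ^ 2 - 4 * G.coeff 0 * G.coeff 2) =
      ((B : ℤ) * G.coeff 1) ^ 2 - 4 * ((B : ℤ) * G.coeff 0) * ((B : ℤ) * G.coeff 2) := by ring
  rw [this, e2, e1, e0]
  ring

end Quadratic

end

end Summit.Parity.BatemanHorn.Cruxes.LSDRealSegment.ProductAnatomySubcritical
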